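import Mathlib.MeasureTheory.Measure.Haar.InnerProductSpace
import Literature.Analysis.FunctionSpaces.SmoothCutoff
import Literature.Analysis.FunctionSpaces.TorusMollifier
import Literature.Analysis.FunctionSpaces.TorusCalculus
import HarnessLib

/-!
# De Rosa–Isett's space–time cut-off (Lemma 5.2) on `ℝ × T^d`

Analysis/FunctionSpaces support file (theorem-only; serves the discharge of
`Literature.Barriers.AnomalousDissipation.DeRosaIsett2024_s51_finalBound`). De Rosa–Isett
(ARMA 248 (2024) = arXiv:2212.08176), Lemma 5.2: for a space–time set `S` and `δ > 0` there is a
smooth cut-off `χ_δ` with `χ_δ ≡ 1` on the `δ`-neighbourhood `(S)_{δ,δ}`, `χ_δ ≡ 0` off a larger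
neighbourhood, and `|∂ₜχ_δ| + |∇χ_δ| ≲ δ⁻¹` ("the space–time mollification at scale `δ`,
`χ_δ = 𝟙_{(S)_{2δ,2δ}} ∗_{x,t} ρ_δ`, satisfies all the claimed properties"). Here on `ℝ × T^d` with the
sup-metric neighbourhoods `Metric.thickening` of the tree's `DeRosaIsett2024_thm27`
(`Torus.exists_spaceTime_cutoff`): the cut-off of the lifted (lattice-periodic) set
`{(t, y) : (t, proj y) ∈ (S)_{2δ}} ⊆ ℝ × ℝ^d` from `SmoothCutoff` (scale `δ`, sup-norm cylinders)
is lattice periodic, hence descends to `χ : ℝ → T^d → ℝ` with smooth space–time lift, `χ = 1` on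
`(S)_δ`, `χ = 0` off `(S)_{3δ}`, and `|∂ₜχ|, ‖∇ₓχ‖ ≤ C/δ` with `C` depending only on `d`. The printed
`L^q` bounds (est_chi)–(est_chi_der) then follow from the Minkowski-content hypothesis on `S` in the
consumer.

## Mathlib search

Mathlib (this pin): `Metric.thickening`, `Prod` sup metric (`Prod.dist_eq`), chain rule; the torus
side is the tree's (`FlatTorus`: `proj`, `repr`, `proj_eq_proj_iff_holds`, `norm_proj_le`;
`TorusCalculus`: `stLift`, `timeDeriv`, `Torus.gradient`).

## References

* L. De Rosa, P. Isett, Arch. Ration. Mech. Anal. 248 (2024), Paper No. 11, Lemma 5.2 and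
  §5.1 (split_D). [DeRosaIsett2024]
-/

noncomputable section

open MeasureTheory Set Filter Topology Function Metric
open scoped ENNReal NNReal ContDiff

namespace Literature.Analysis.FunctionSpaces.Torus

variable {d : Type*} [Fintype d]

/-- `dist (proj a) (proj b) ≤ ‖a - b‖`: the quotient map `ℝ^d → T^d` is `1`-Lipschitz. [folklore] -/
theorem dist_proj_proj_le (a b : EuclideanSpace ℝ d) : dist (proj a) (proj b) ≤ ‖a - b‖ := by
  have h : proj a - proj b = proj (a - b) := by
    rw [sub_eq_add_neg, sub_eq_add_neg, proj_add, proj_neg]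
  rw [dist_eq_norm, h]
  exact norm_proj_le _

/-- The thickening of a thickening: a `δ`-ball around a point of `(S)_ε` lies in `(S)_{δ+ε}`. [folklore] -/
theorem ball_subset_thickening_of_mem_thickening {X : Type*} [PseudoMetricSpace X] {S : Set X}
    {ε δ : ℝ} {x : X} (hx : x ∈ thickening ε S) : ball x δ ⊆ thickening (δ + ε) S := by
  intro y hy
  rw [mem_thickening_iff] at hx ⊢
  obtain ⟨p, hp, hxp⟩ := hx
  refine ⟨p, hp, ?_⟩
  calc dist y p ≤ dist y x + dist x p := dist_triangle _ _ _
    _ < δ + ε := add_lt_add (mem_ball.1 hy) hxp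

/-- **De Rosa–Isett's space–time cut-off on `ℝ × T^d`** (op. cit. Lemma 5.2, sup-metric
neighbourhoods): there is `C ≥ 0` depending only on `d` such that for every `S ⊆ ℝ × T^d` and
`δ > 0` there is `χ : ℝ → T^d → ℝ` with smooth space–time lift, values in `[0,1]`, `χ = 1` on the
`δ`-neighbourhood of `S`, `χ = 0` off the `3δ`-neighbourhood, and `|∂ₜχ| ≤ C/δ`, `‖∇ₓχ‖ ≤ C/δ`
everywhere. [cite: DeRosaIsett2024, Lemma 5.2] -/
theorem exists_spaceTime_cutoff [DecidableEq d] :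
    ∃ C : ℝ, 0 ≤ C ∧ ∀ (S : Set (ℝ × UnitAddTorus d)) (δ : ℝ), 0 < δ →
      ∃ χ : ℝ → UnitAddTorus d → ℝ, ContDiff ℝ ∞ (stLift χ) ∧ (∀ t x, 0 ≤ χ t x ∧ χ t x ≤ 1) ∧
        (∀ z ∈ thickening δ S, χ z.1 z.2 = 1) ∧ (∀ z, z ∉ thickening (3 * δ) S → χ z.1 z.2 = 0) ∧
        (∀ t x, |timeDeriv χ t x| ≤ C / δ) ∧ (∀ t x, ‖Torus.gradient (χ t) x‖ ≤ C / δ) := by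
  obtain ⟨C, hC0, hC⟩ := exists_smooth_cutoff_periodic
    ((volume : Measure ℝ).prod (volume : Measure (EuclideanSpace ℝ d)))
  refine ⟨C, hC0, fun S δ hδ => ?_⟩
  -- the lifted, lattice-periodic set
  set A : Set (ℝ × EuclideanSpace ℝ d) := {z | (z.1, proj z.2) ∈ thickening (2 * δ) S} with hA
  have hPc : Continuous fun z : ℝ × EuclideanSpace ℝ d => (z.1, proj z.2) :=
    continuous_fst.prodMk (continuous_proj.comp continuous_snd)
  have hAm : MeasurableSet A := (isOpen_thickening.preimage hPc).measurableSet
  obtain ⟨Χ, hΧs, hΧ01, hΧ1, hΧ0, hΧd, hΧp⟩ := hC A hAm δ hδ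
  -- periodicity under the lattice
  have hper : ∀ (m : d → ℤ) (z : ℝ × EuclideanSpace ℝ d), Χ (z + (0, latticeVec m)) = Χ z := by
    intro m z
    refine hΧp (0, latticeVec m) (fun w => ?_) z
    simp only [hA, mem_setOf_eq, Prod.fst_add, Prod.snd_add, add_zero, proj_add_latticeVec]
  -- the descended cut-off
  set χ : ℝ → UnitAddTorus d → ℝ := fun t x => Χ (t, repr x) with hχ
  have hlift : stLift χ = Χ := by
    funext z
    obtain ⟨t, y⟩ := z
    simp only [stLift_apply, hχ]
    obtain ⟨m, hm⟩ := (proj_eq_proj_iff_holds y (repr (proj y))).1 (proj_repr (proj y)).symm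
    rw [hm]
    have := hper m (t, y)
    simpa using this
  -- balls in the lift project into sup-metric balls downstairs
  have hball : ∀ (t : ℝ) (y : EuclideanSpace ℝ d) (w : ℝ × EuclideanSpace ℝ d),
      w ∈ ball ((t, y) : ℝ × EuclideanSpace ℝ d) δ → (w.1, proj w.2) ∈ ball (t, proj y) δ := by
    intro t y w hw
    rw [mem_ball, Prod.dist_eq] at hw ⊢
    refine max_lt (lt_of_le_of_lt (le_max_left _ _) hw) ?_
    exact lt_of_le_of_lt ((dist_proj_proj_le _ _).trans (by rw [← dist_eq_norm]; exact le_max_right _ _)) hw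
  refine ⟨χ, by rw [hlift]; exact hΧs, fun t x => hΧ01 _, fun z hz => ?_, fun z hz => ?_, fun t x => ?_,
    fun t x => ?_⟩
  · -- `χ = 1` on the `δ`-neighbourhood
    obtain ⟨t, x⟩ := z
    show Χ (t, repr x) = 1
    refine hΧ1 _ fun w hw => ?_
    have h1 := hball t (repr x) w hw
    rw [proj_repr] at h1
    show (w.1, proj w.2) ∈ thickening (2 * δ) S
    have h2 := ball_subset_thickening_of_mem_thickening (δ := δ) hz h1
    rwa [show δ + δ = 2 * δ by ring] at h2
  · -- `χ = 0` off the `3δ`-neighbourhood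
    obtain ⟨t, x⟩ := z
    show Χ (t, repr x) = 0
    refine hΧ0 _ (disjoint_left.2 fun w hw hwA => hz ?_)
    have h1 := hball t (repr x) w hw
    rw [proj_repr] at h1
    have h2 : ((t, x) : ℝ × UnitAddTorus d) ∈ ball (w.1, proj w.2) δ := by
      rw [mem_ball, dist_comm]; exact mem_ball.1 h1
    have h3 := ball_subset_thickening_of_mem_thickening (δ := δ) hwA h2
    rwa [show δ + 2 * δ = 3 * δ by ring] at h3
  · -- time derivative
    have hdiff : Differentiable ℝ Χ := hΧs.differentiable (by simp)
    have hcurve : HasDerivAt (fun s : ℝ => ((s, repr x) : ℝ × EuclideanSpace ℝ d)) (1, 0) t :=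
      (hasDerivAt_id t).prodMk (hasDerivAt_const t (repr x))
    have hcomp : HasDerivAt (fun s => Χ (s, repr x)) (_root_.fderiv ℝ Χ (t, repr x) (1, 0)) t :=
      (hdiff (t, repr x)).hasFDerivAt.comp_hasDerivAt t hcurve
    have e : timeDeriv χ t x = _root_.fderiv ℝ Χ (t, repr x) (1, 0) := by
      rw [timeDeriv]
      exact hcomp.deriv
    rw [e]
    calc |_root_.fderiv ℝ Χ (t, repr x) (1, 0)| = ‖_root_.fderiv ℝ Χ (t, repr x) (1, 0)‖ := (Real.norm_eq_abs _).symm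
      _ ≤ ‖_root_.fderiv ℝ Χ (t, repr x)‖ * ‖((1, 0) : ℝ × EuclideanSpace ℝ d)‖ := ContinuousLinearMap.le_opNorm _ _
      _ ≤ C / δ * 1 := by
          gcongr
          · exact hΧd _
          · simp [Prod.norm_def]
      _ = C / δ := mul_one _
  · -- space gradient
    have hdiff : Differentiable ℝ Χ := hΧs.differentiable (by simp)
    have hliftAt : liftAt (χ t) x = fun v => Χ (t, repr x + v) := by
      funext v
      rw [liftAt_apply]
      have h1 : χ t (x + proj v) = stLift χ (t, repr x + v) := by
        rw [stLift_apply, proj_add, proj_repr]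
      rw [h1, hlift]
    have hcurve : HasFDerivAt (fun v : EuclideanSpace ℝ d => ((t, repr x + v) : ℝ × EuclideanSpace ℝ d))
        (ContinuousLinearMap.inr ℝ ℝ (EuclideanSpace ℝ d)) 0 := by
      have h1 : HasFDerivAt (fun v : EuclideanSpace ℝ d => repr x + v) (ContinuousLinearMap.id ℝ _) 0 :=
        (hasFDerivAt_id (0 : EuclideanSpace ℝ d)).const_add (repr x)
      exact (hasFDerivAt_const t 0).prodMk h1
    have hcomp : HasFDerivAt (fun v => Χ (t, repr x + v))
        ((_root_.fderiv ℝ Χ (t, repr x + 0)).comp (ContinuousLinearMap.inr ℝ ℝ (EuclideanSpace ℝ d))) 0 :=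
      (hdiff (t, repr x + 0)).hasFDerivAt.comp 0 hcurve
    rw [add_zero] at hcomp
    have e : Torus.gradient (χ t) x =
        (InnerProductSpace.toDual ℝ (EuclideanSpace ℝ d)).symm
          ((_root_.fderiv ℝ Χ (t, repr x)).comp (ContinuousLinearMap.inr ℝ ℝ (EuclideanSpace ℝ d))) := by
      rw [Torus.gradient, hliftAt, _root_.gradient, hcomp.fderiv]
    rw [e, LinearIsometryEquiv.norm_map]
    refine ContinuousLinearMap.opNorm_le_bound _ (by positivity) fun v => ?_
    calc ‖((_root_.fderiv ℝ Χ (t, repr x)).comp (ContinuousLinearMap.inr ℝ ℝ (EuclideanSpace ℝ d))) v‖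
        = ‖_root_.fderiv ℝ Χ (t, repr x) (0, v)‖ := rfl
      _ ≤ ‖_root_.fderiv ℝ Χ (t, repr x)‖ * ‖((0, v) : ℝ × EuclideanSpace ℝ d)‖ := ContinuousLinearMap.le_opNorm _ _
      _ ≤ C / δ * ‖v‖ := by
          gcongr
          · exact hΧd _
          · simp [Prod.norm_def]

end Literature.Analysis.FunctionSpaces.Torus

end
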